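import Literature.RepresentationTheory.Virasoro.KacCharacterReduction
import Literature.RepresentationTheory.Virasoro.FockSingularVectorsNonzero
import Literature.RepresentationTheory.Virasoro.FockGenericEmbedding
import Literature.RepresentationTheory.Virasoro.VermaFamily
import Literature.RepresentationTheory.Virasoro.PolynomialMatrixKernel
import Mathlib.FieldTheory.IsAlgClosed.Basic
import Mathlib.Analysis.Complex.Polynomial.Basic

/-!
# Existence of the level-`rs` singular vectors (Iohara–Koga Proposition 5.2) and the Kac character

We discharge the named fact `Literature.RepresentationTheory.Virasoro.KacCharacter`
(`Literature.RepresentationTheory.Virasoro.VermaModule`, Pearce–Rasmussen–Zuber 2006 §2.2: the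
character of the Kac quotient `K_{r,s} = V_{h_{r,s}}/V_{h_{r,s}+rs}` is
`q^{h_{r,s}}(1 - q^{rs})/∏(1 - qⁿ)`) by proving the one remaining input of
`Literature.RepresentationTheory.Virasoro.KacCharacterReduction`
(`KacCharacter_iff_exists_singular`): **for every `t ≠ 0` and `r, s ≥ 1` the Verma module
`V(c(t), h_{r,s}(t))` has a singular vector of level `rs`** (`Verma.exists_singularVector_kac`;
Iohara–Koga Proposition 5.2 / Corollary 5.2, Feigin–Fuchs). The proof follows Iohara–Koga
§4.3–§4.4 and §5.2.2, with the vertex-algebra formalism replaced by the polynomial screening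
calculus of `FockSingularVectors` and the Kac determinant FORMULA replaced by a direct closure
argument for the singular-vector equations:

1. (**zero source at the integer points**, Iohara–Koga Lemma 4.11) for `t = p ∈ ℕ`, `p ≥ 1`,
   `β² = 2p`: the Fock module `F_{λ(β)}^{μ_{r,s}(β)}` (`c = c(p)`, `h = h_{r,s}(p)`) contains a
   non-zero vector `u` of level `rs` annihilated by `Vir⁺`
   (`Fock.exists_singularVector_fock`, files `FockSingularVectors`, `FockSingularVectorsNonzero`);
2. (**generic injectivity of `Γ : V → F`**, Iohara–Koga Theorem 4.3 (1) along the curve) for all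
   but finitely many `β` the words `e_𝕀|μ(β)⟩` are independent on the levels `rs, rs-1, rs-2`
   (`Fock.exists_finset_linearIndependent_partitionVector`, file `FockGenericEmbedding`), so for
   `p` large `u = Γ(w)` with `w` of level `rs` (a dimension count in the Fock space,
   `Fock.mem_span_of_linearIndependent`) and `Γ(L_k w) = L_k u = 0` forces `L_1 w = L_2 w = 0`
   (`exists_mulVec_eq_zero_nat`): `V(c(p), h_{r,s}(p))` has a singular vector of level `rs` for all
   large `p ∈ ℕ` — infinitely many points of the curve (`infinite_setOf_mulVec_eq_zero`);
3. (**the system over the coordinate ring**, Iohara–Koga Proposition 5.2, proof) the conditions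
   `L_1 (Σ a_𝕀 e_𝕀 v) = L_2 (Σ a_𝕀 e_𝕀 v) = 0` are a linear system in `(a_𝕀)` whose coefficients are
   the universal structure constants `C^{(k)}_{𝕀,𝕁}(c,h) ∈ ℂ[c,h]` (`VermaFamily`) restricted to the
   curve and homogenised to POLYNOMIALS in `t` (`curveSubst`, `sysMatrix`,
   `sysMatrix_mulVec_eq_zero_iff`, using the PBW theorem and
   `VirasoroRep.annihilated_iff_L_one_L_two`);
4. (**closure**, Iohara–Koga Lemma 4.12 / Proposition 5.2) a polynomial matrix whose
   specialisations have non-trivial kernel at infinitely many points has non-trivial kernel at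
   EVERY point (`PolynomialMatrixKernel`), whence the singular vector for every `t ≠ 0`
   (`exists_singular_of_infinite`) and **`KacCharacter_holds`**.

## References

* [PearceRasmussenZuber2006] P. A. Pearce, J. Rasmussen, J.-B. Zuber, *Logarithmic minimal models*,
  J. Stat. Mech. (2006) P11017, §2.2.
* [IoharaKoga2011] K. Iohara, Y. Koga, *Representation theory of the Virasoro algebra*, Springer 2011,
  Lemma 4.11, Lemma 4.12, Proposition 5.1, Proposition 5.2, Corollary 5.2.
-/

noncomputable section

namespace Literature.RepresentationTheory.Virasoro

/-! ### The Kac curve `t ↦ (c(t), h_{r,s}(t))`, homogenised to polynomials in `t` -/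

section Curve

open Polynomial

variable (r s : ℕ)

/-- `t · c(t) = 13t - 6t² - 6` as a polynomial. [cite: IoharaKoga2011, eq. (5.4)] -/
def tcPoly : ℂ[X] := Polynomial.C 13 * Polynomial.X - Polynomial.C 6 * Polynomial.X ^ 2 - Polynomial.C 6

/-- `t · h_{r,s}(t) = ¼(r²-1)t² - ½(rs-1)t + ¼(s²-1)` as a polynomial. [cite: IoharaKoga2011, eq. (5.4)] -/
def thPoly (r s : ℕ) : ℂ[X] :=
  Polynomial.C (((r : ℂ) ^ 2 - 1) / 4) * Polynomial.X ^ 2 - Polynomial.C (((r : ℂ) * s - 1) / 2) * Polynomial.X +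
    Polynomial.C (((s : ℂ) ^ 2 - 1) / 4)

/-- `(t·c)(t) = t c(t)`. [folklore] -/
theorem eval_tcPoly {t : ℂ} (ht : t ≠ 0) : (tcPoly).eval t = t * centralChargeOf t := by
  simp only [tcPoly, eval_sub, eval_mul, eval_C, eval_X, eval_pow, centralChargeOf]
  field_simp
  ring

/-- `(t·h)(t) = t h_{r,s}(t)`. [folklore] -/
theorem eval_thPoly {t : ℂ} (ht : t ≠ 0) : (thPoly r s).eval t = t * kacWeight t r s := by
  simp only [thPoly, eval_sub, eval_add, eval_mul, eval_C, eval_X, eval_pow, kacWeight]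
  push_cast
  field_simp

/-- **Homogenised substitution** of the curve into a polynomial in `(C, H)`:
`f ↦ Σ_e [C^{e₀}H^{e₁}]f · (tC)^{e₀} (tH)^{e₁} t^{M - e₀ - e₁}`, a polynomial in `t` which for
`M ≥ deg f` evaluates to `t^M f(c(t), h_{r,s}(t))`. [cite: IoharaKoga2011, Proposition 5.2 (proof: the system over the coordinate ring ℂ[𝒱_{α,β}])] -/
def curveSubst (M : ℕ) (f : CHRing) : ℂ[X] :=
  ∑ e ∈ f.support, Polynomial.C (MvPolynomial.coeff e f) * tcPoly ^ (e 0) * thPoly r s ^ (e 1) *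
    Polynomial.X ^ (M - e 0 - e 1)

/-- The evaluation property of the homogenised substitution. [folklore] -/
theorem eval_curveSubst {M : ℕ} {f : CHRing} (hM : f.totalDegree ≤ M) {t : ℂ} (ht : t ≠ 0) :
    (curveSubst r s M f).eval t = t ^ M * evalCH (centralChargeOf t) (kacWeight t r s) f := by
  have hdeg : ∀ e ∈ f.support, e 0 + e 1 ≤ M := by
    intro e he
    have h1 := MvPolynomial.le_totalDegree he
    rw [show (e.sum fun _ n => n) = e 0 + e 1 by
      rw [Finsupp.sum_fintype _ _ (fun _ => rfl), Fin.sum_univ_two]] at h1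
    exact h1.trans hM
  rw [curveSubst, eval_finsetSum, evalCH, MvPolynomial.eval_eq', Finset.mul_sum]
  refine Finset.sum_congr rfl fun e he => ?_
  simp only [eval_mul, eval_C, eval_pow, eval_X, eval_tcPoly ht, eval_thPoly r s ht, Fin.prod_univ_two,
    Matrix.cons_val_zero, Matrix.cons_val_one]
  have hsplit : t ^ M = t ^ (e 0) * t ^ (e 1) * t ^ (M - e 0 - e 1) := by
    rw [← pow_add, ← pow_add]; congr 1; have := hdeg e he; omega
  rw [hsplit, mul_pow, mul_pow]
  ring

end Curve

/-! ### The linear system for a singular vector of level `N` along the curve -/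

section System

open Polynomial

variable (r s N : ℕ)

/-- The row index: a partition of `N - 1` (an `L_1`-equation) or of `N - 2` (an `L_2`-equation). [folklore] -/
abbrev RowIx (N : ℕ) : Type := Nat.Partition (N - 1) ⊕ Nat.Partition (N - 2)

/-- The universal entries: the structure constants `C^{(1)}_{𝕀,𝕁}`, `C^{(2)}_{𝕀,𝕁} ∈ ℂ[C, H]`. [cite: IoharaKoga2011, eq. (4.18)] -/
def sysEntry (N : ℕ) : RowIx N → Nat.Partition N → CHRing
  | Sum.inl J, I => strConst 1 N one_pos I J
  | Sum.inr J, I => strConst 2 N two_pos I J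

/-- A common bound for the total degrees of the entries. [folklore] -/
def sysDeg (N : ℕ) : ℕ := Finset.univ.sup fun ij : RowIx N × Nat.Partition N => (sysEntry N ij.1 ij.2).totalDegree

/-- Every entry has total degree at most `sysDeg N`. [folklore] -/
theorem totalDegree_sysEntry_le (i : RowIx N) (I : Nat.Partition N) : (sysEntry N i I).totalDegree ≤ sysDeg N :=
  Finset.le_sup (f := fun ij : RowIx N × Nat.Partition N => (sysEntry N ij.1 ij.2).totalDegree) (Finset.mem_univ (i, I))

/-- **The polynomial matrix of the singular-vector equations along the Kac curve**: its kernel at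
`t ≠ 0` is the space of coordinate vectors `(a_𝕀)` with `L_1 (Σ a_𝕀 e_𝕀 v) = L_2 (Σ a_𝕀 e_𝕀 v) = 0` in
`V(c(t), h_{r,s}(t))`. [cite: IoharaKoga2011, Proposition 5.2 (the system of linear equations (5.31))] -/
def sysMatrix : Matrix (RowIx N) (Nat.Partition N) ℂ[X] :=
  fun i I => curveSubst r s (sysDeg N) (sysEntry N i I)

/-- The vector with coordinates `a` in the PBW basis of `V(c,h)_{h+N}`. [folklore] -/
def coordVec (c h : ℂ) (a : Nat.Partition N → ℂ) : Verma c h :=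
  ∑ I, a I • (Verma.rep c h).partitionVector I (Verma.hw c h)

/-- `Σ a_𝕀 e_𝕀 v` lies in the level-`N` space. [folklore] -/
theorem coordVec_mem_levelSpace (c h : ℂ) (a : Nat.Partition N → ℂ) :
    coordVec N c h a ∈ (Verma.rep c h).levelSpace (Verma.hw c h) N :=
  Submodule.sum_mem _ fun I _ => Submodule.smul_mem _ _ ((Verma.rep c h).partitionVector_mem_levelSpace _ I)

/-- `Σ a_𝕀 e_𝕀 v = 0 ↔ a = 0` (PBW). [cite: IoharaKoga2011, §4.4.2 (the basis e_𝕀 v_{c,h})] -/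
theorem coordVec_eq_zero_iff (c h : ℂ) (a : Nat.Partition N → ℂ) : coordVec N c h a = 0 ↔ a = 0 := by
  constructor
  · intro h0
    funext I
    exact Fintype.linearIndependent_iff.mp (Verma.linearIndependent_partitionVector c h N) a h0 I
  · rintro rfl
    exact Finset.sum_eq_zero fun I _ => zero_smul ℂ ((Verma.rep c h).partitionVector I (Verma.hw c h))

/-- `L_k (Σ a_𝕀 e_𝕀 v) = Σ_𝕁 (Σ_𝕀 a_𝕀 C^{(k)}_{𝕀,𝕁}(c,h)) e_𝕁 v`. [cite: IoharaKoga2011, eq. (4.18)] -/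
theorem L_coordVec (k : ℕ) (hk : 0 < k) (c h : ℂ) (a : Nat.Partition N → ℂ) :
    (Verma.rep c h).L k (coordVec N c h a) =
      ∑ J : Nat.Partition (N - k), (∑ I, a I * evalCH c h (strConst k N hk I J)) •
        (Verma.rep c h).partitionVector J (Verma.hw c h) := by
  rw [coordVec, map_sum]
  have lhs : ∀ I : Nat.Partition N, (Verma.rep c h).L k (a I • (Verma.rep c h).partitionVector I (Verma.hw c h)) =
      ∑ J : Nat.Partition (N - k), a I • (evalCH c h (strConst k N hk I J) •
        (Verma.rep c h).partitionVector J (Verma.hw c h)) := fun I => by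
    rw [map_smul, L_partitionVector_eq_sum_strConst k N hk I c h, Verma.smul_sum']
  rw [Finset.sum_congr rfl fun I _ => lhs I, Finset.sum_comm]
  refine Finset.sum_congr rfl fun J _ => ?_
  rw [Verma.sum_smul']
  exact Finset.sum_congr rfl fun I _ => (Verma.mul_smul' _ _ _).symm

/-- `L_k (Σ a_𝕀 e_𝕀 v) = 0 ↔ ∀ 𝕁, Σ_𝕀 a_𝕀 C^{(k)}_{𝕀,𝕁}(c,h) = 0` (PBW at level `N - k`). [cite: IoharaKoga2011, Proposition 5.2 (proof)] -/
theorem L_coordVec_eq_zero_iff (k : ℕ) (hk : 0 < k) (c h : ℂ) (a : Nat.Partition N → ℂ) :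
    (Verma.rep c h).L k (coordVec N c h a) = 0 ↔ ∀ J : Nat.Partition (N - k), ∑ I, a I * evalCH c h (strConst k N hk I J) = 0 := by
  rw [L_coordVec N k hk c h a]
  constructor
  · intro h0 J
    exact Fintype.linearIndependent_iff.mp (Verma.linearIndependent_partitionVector c h (N - k)) _ h0 J
  · intro hall
    exact Finset.sum_eq_zero fun J _ => by
      rw [hall J]; exact zero_smul ℂ ((Verma.rep c h).partitionVector J (Verma.hw c h))

/-- **The kernel of the specialised system is the space of singular vectors of level `N`**:
for `t ≠ 0`, `A(t) a = 0 ↔ L_1 (Σ a_𝕀 e_𝕀 v) = 0 ∧ L_2 (Σ a_𝕀 e_𝕀 v) = 0` in `V(c(t), h_{r,s}(t))`.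
[cite: IoharaKoga2011, Proposition 5.2 (proof: "the condition (5.31) is equivalent to a system of linear equations")] -/
theorem sysMatrix_mulVec_eq_zero_iff {t : ℂ} (ht : t ≠ 0) (a : Nat.Partition N → ℂ) :
    (Matrix.evalAt (sysMatrix r s N) t).mulVec a = 0 ↔
      (Verma.rep (centralChargeOf t) (kacWeight t r s)).L 1 (coordVec N _ _ a) = 0 ∧
        (Verma.rep (centralChargeOf t) (kacWeight t r s)).L 2 (coordVec N _ _ a) = 0 := by
  have hrow : ∀ i : RowIx N, (Matrix.evalAt (sysMatrix r s N) t).mulVec a i =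
      t ^ sysDeg N * ∑ I, a I * evalCH (centralChargeOf t) (kacWeight t r s) (sysEntry N i I) := by
    intro i
    rw [Matrix.mulVec, dotProduct, Finset.mul_sum]
    refine Finset.sum_congr rfl fun I _ => ?_
    rw [show Matrix.evalAt (sysMatrix r s N) t i I = (curveSubst r s (sysDeg N) (sysEntry N i I)).eval t from rfl,
      eval_curveSubst r s (totalDegree_sysEntry_le N i I) ht]
    ring
  have htM : t ^ sysDeg N ≠ 0 := pow_ne_zero _ ht
  rw [show (1 : ℤ) = ((1 : ℕ) : ℤ) from rfl, show (2 : ℤ) = ((2 : ℕ) : ℤ) from rfl,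
    L_coordVec_eq_zero_iff N 1 one_pos, L_coordVec_eq_zero_iff N 2 two_pos]
  constructor
  · intro h0
    refine ⟨fun J => ?_, fun J => ?_⟩
    · have := congrFun h0 (Sum.inl J)
      rw [hrow, Pi.zero_apply, mul_eq_zero] at this
      exact this.resolve_left htM
    · have := congrFun h0 (Sum.inr J)
      rw [hrow, Pi.zero_apply, mul_eq_zero] at this
      exact this.resolve_left htM
  · rintro ⟨h1, h2⟩
    funext i
    rw [hrow, Pi.zero_apply]
    rcases i with J | J
    · rw [show (∑ I, a I * evalCH _ _ (sysEntry N (Sum.inl J) I)) = 0 from h1 J, mul_zero]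
    · rw [show (∑ I, a I * evalCH _ _ (sysEntry N (Sum.inr J) I)) = 0 from h2 J, mul_zero]

/-- **From a kernel vector to a singular vector**: if `A(t) a = 0` with `a ≠ 0` then
`w = Σ a_𝕀 e_𝕀 v_{c(t),h_{r,s}(t)}` is a non-zero primary vector of weight `h_{r,s}(t) + N`.
[cite: IoharaKoga2011, Proposition 5.2 and eq. (5.28)] -/
theorem exists_singular_of_mulVec_eq_zero {t : ℂ} (ht : t ≠ 0) {a : Nat.Partition N → ℂ} (ha : a ≠ 0)
    (hA : (Matrix.evalAt (sysMatrix r s N) t).mulVec a = 0) :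
    ∃ w : Verma (centralChargeOf t) (kacWeight t r s), w ≠ 0 ∧
      (Verma.rep (centralChargeOf t) (kacWeight t r s)).IsPrimary w (kacWeight t r s + N) := by
  set R' := Verma.rep (centralChargeOf t) (kacWeight t r s) with hR'
  obtain ⟨h1, h2⟩ := (sysMatrix_mulVec_eq_zero_iff r s N ht a).mp hA
  refine ⟨coordVec N _ _ a, fun h0 => ha ((coordVec_eq_zero_iff N _ _ a).mp h0), ?_, ?_⟩
  · intro n hn
    obtain ⟨m, rfl⟩ : ∃ m : ℕ, n = m := ⟨n.toNat, by omega⟩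
    exact (R'.annihilated_iff_L_one_L_two (coordVec N _ _ a)).mpr ⟨h1, h2⟩ m (by exact_mod_cast hn)
  · exact R'.L_zero_apply_of_mem_levelSpace Verma.isPrimary_hw.mem_weightSpace (coordVec_mem_levelSpace N _ _ a)

/-- **The closure step**: if the system has non-trivial solutions at infinitely many `t`, it has
them at every `t`, hence `V(c(t), h_{r,s}(t))` has a singular vector of level `N` for EVERY `t ≠ 0`.
[cite: IoharaKoga2011, Proposition 5.2 (proof: "it has a solution for any (c,h) ∈ 𝒱_{α,β}") and Lemma 4.12] -/
theorem exists_singular_of_infinite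
    (hinf : Set.Infinite {t : ℂ | ∃ a : Nat.Partition N → ℂ, a ≠ 0 ∧ (Matrix.evalAt (sysMatrix r s N) t).mulVec a = 0})
    {t : ℂ} (ht : t ≠ 0) :
    ∃ w : Verma (centralChargeOf t) (kacWeight t r s), w ≠ 0 ∧
      (Verma.rep (centralChargeOf t) (kacWeight t r s)).IsPrimary w (kacWeight t r s + N) := by
  rcases Matrix.forall_exists_mulVec_eq_zero_or_finite (sysMatrix r s N) with hall | hfin
  · obtain ⟨a, ha, hA⟩ := hall t
    exact exists_singular_of_mulVec_eq_zero r s N ht ha hA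
  · exact absurd hfin hinf

end System

/-! ### Transport of structure along an equality of central charges -/

namespace VirasoroRep

variable {c c' : ℂ} {V : Type*} [AddCommGroup V] [Module ℂ V]

/-- The same operators, viewed as a representation of central charge `c' = c`. [folklore] -/
def ofEq (R : VirasoroRep c V) (hc : c = c') : VirasoroRep c' V where
  L := R.L
  lie m n x := by subst hc; exact R.lie m n x

/-- The operators are unchanged. [folklore] -/
@[simp] theorem ofEq_L (R : VirasoroRep c V) (hc : c = c') : (R.ofEq hc).L = R.L := rfl

/-- PBW monomials are unchanged. [folklore] -/
theorem ofEq_partitionVector (R : VirasoroRep c V) (hc : c = c') {N : ℕ} (I : Nat.Partition N) (v : V) :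
    (R.ofEq hc).partitionVector I v = R.partitionVector I v := rfl

/-- Primary vectors are unchanged (with the weight rewritten). [folklore] -/
theorem IsPrimary.ofEq {R : VirasoroRep c V} {v : V} {h h' : ℂ} (hv : R.IsPrimary v h) (hc : c = c')
    (hh : h = h') : (R.ofEq hc).IsPrimary v h' :=
  ⟨hv.annihilated, by rw [← hh]; exact hv.weight⟩

end VirasoroRep

/-! ### The level pieces of the Fock space are spanned by independent PBW words -/

namespace Fock

open MvPolynomial

/-- The coefficients of the Euler derivation: `[x^d] D_0 v = |d| [x^d] v`. [cite: IoharaKoga2011, §4.2.1] -/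
theorem coeff_D_zero {R : Type*} [CommRing R] (lam mu : R) (v : Space R) (d : ℕ+ →₀ ℕ) :
    coeff d (D R lam mu 0 v) = ((Finsupp.weight lw d : ℕ) : R) * coeff d v := by
  classical
  conv_lhs => rw [v.as_sum, map_sum]
  rw [coeff_sum]
  simp_rw [D_zero_monomial, coeff_smul, coeff_monomial, smul_eq_mul, mul_ite, mul_zero]
  rw [Finset.sum_ite_eq']
  split_ifs with h
  · rfl
  · rw [MvPolynomial.mem_support_iff, not_not] at h
    rw [h, mul_zero]

/-- **Eigenvectors of `L_0` are homogeneous**: if `L_0 v = (h + N) v` (`h = ½μ² - λμ`) in `F_λ^μ`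
then `v` has level `N`. [cite: IoharaKoga2011, §4.2.1 ((F^η_λ)_{h+n} = (F^η)^{-nα})] -/
theorem isWeightedHomogeneous_of_L_zero (lam mu : ℂ) {v : Space ℂ} {N : ℕ}
    (hv : L ℂ lam mu 0 v = (hval ℂ lam mu + N) • v) : IsWeightedHomogeneous lw v N := by
  have hD : D ℂ lam mu 0 v = (N : ℂ) • v := by
    have h1 : L ℂ lam mu 0 v = D ℂ lam mu 0 v + hval ℂ lam mu • v := by
      simp only [L, LinearMap.add_apply, LinearMap.mulLeft_apply, Derivation.coeFn_coe, if_true, LinearMap.smul_apply,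
        Module.End.one_apply, Int.toNat_zero, aa_zero, P_of_nonneg lam mu (le_refl (0 : ℤ)), zero_mul, zero_add,
        add_zero]
    rw [h1, add_smul] at hv
    exact add_right_cancel (hv.trans (add_comm _ _))
  intro d hd
  have h2 := congrArg (coeff d) hD
  rw [coeff_D_zero, coeff_smul, smul_eq_mul] at h2
  exact_mod_cast (mul_right_cancel₀ hd h2)

/-- The partition of `N` attached to an exponent vector of level `N` (the letter `n` repeated `d_n`
times). [folklore] -/
def expToPartition (N : ℕ) (d : {d : ℕ+ →₀ ℕ // Finsupp.weight lw d = N}) : Nat.Partition N where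
  parts := (Finsupp.toMultiset d.1).map PNat.val
  parts_pos hi := by
    obtain ⟨a, -, rfl⟩ := Multiset.mem_map.mp hi
    exact a.pos
  parts_sum := by
    -- both sides are additive in `d`; check on `single a n`
    suffices h : ∀ e : ℕ+ →₀ ℕ, ((Finsupp.toMultiset e).map PNat.val).sum = Finsupp.weight lw e from
      (h d.1).trans d.2
    intro e
    induction e using Finsupp.induction with
    | zero => simp
    | single_add a n f _ _ ih =>
      rw [map_add, Multiset.map_add, Multiset.sum_add, ih, map_add, Finsupp.toMultiset_single, Multiset.map_nsmul,
        Multiset.sum_nsmul, Multiset.map_singleton, Multiset.sum_singleton, Finsupp.weight_apply lw (Finsupp.single a n),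
        Finsupp.sum_single_index (by simp)]

/-- The exponent vector is determined by its partition. [folklore] -/
theorem expToPartition_injective (N : ℕ) : Function.Injective (expToPartition N) := by
  classical
  intro d d' h
  have h1 : (Finsupp.toMultiset d.1).map PNat.val = (Finsupp.toMultiset d'.1).map PNat.val := congrArg Nat.Partition.parts h
  have h2 := congrArg Multiset.toFinsupp (Multiset.map_injective PNat.coe_injective h1)
  rw [Finsupp.toMultiset_toFinsupp, Finsupp.toMultiset_toFinsupp] at h2
  exact Subtype.ext h2

/-- The exponent vectors of level `N` form a finite type. [folklore] -/
instance fintypeExp (N : ℕ) : Fintype {d : ℕ+ →₀ ℕ // Finsupp.weight lw d = N} :=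
  Fintype.ofInjective _ (expToPartition_injective N)

/-- There are at most `p(N)` exponent vectors of level `N`. [folklore] -/
theorem card_exp_le (N : ℕ) : Fintype.card {d : ℕ+ →₀ ℕ // Finsupp.weight lw d = N} ≤ Fintype.card (Nat.Partition N) :=
  Fintype.card_le_of_injective _ (expToPartition_injective N)

/-- The level-`N` piece of the Fock space. [cite: IoharaKoga2011, §4.2.1] -/
abbrev levelPiece (N : ℕ) : Submodule ℂ (Space ℂ) := weightedHomogeneousSubmodule ℂ lw N

/-- The level-`N` piece lies in the span of the monomials of level `N`. [folklore] -/
theorem levelPiece_le_span (N : ℕ) :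
    levelPiece N ≤ Submodule.span ℂ (Set.range fun d : {d : ℕ+ →₀ ℕ // Finsupp.weight lw d = N} => (monomial d.1 (1 : ℂ))) := by
  intro v hv
  rw [mem_weightedHomogeneousSubmodule] at hv
  rw [v.as_sum]
  refine Submodule.sum_mem _ fun d hd => ?_
  have hw : Finsupp.weight lw d = N := hv (MvPolynomial.mem_support_iff.mp hd)
  rw [show monomial d (coeff d v) = coeff d v • monomial d (1 : ℂ) by rw [smul_monomial, smul_eq_mul, mul_one]]
  exact Submodule.smul_mem _ _ (Submodule.subset_span ⟨⟨d, hw⟩, rfl⟩)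

/-- The level pieces of the Fock space are finite-dimensional. [cite: IoharaKoga2011, §4.2.1] -/
theorem finiteDimensional_levelPiece (N : ℕ) : FiniteDimensional ℂ (levelPiece N) := by
  haveI := FiniteDimensional.span_of_finite ℂ (Set.finite_range fun d : {d : ℕ+ →₀ ℕ // Finsupp.weight lw d = N} =>
    (monomial d.1 (1 : ℂ)))
  exact Submodule.finiteDimensional_of_le (levelPiece_le_span N)

/-- **`dim F_N ≤ p(N)`.** [cite: IoharaKoga2011, §4.2.1 and eq. (4.23) (the basis a_𝕀|η⟩, 𝕀 ∈ 𝒫_n)] -/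
theorem finrank_levelPiece_le (N : ℕ) : Module.finrank ℂ (levelPiece N) ≤ Fintype.card (Nat.Partition N) := by
  haveI := FiniteDimensional.span_of_finite ℂ (Set.finite_range fun d : {d : ℕ+ →₀ ℕ // Finsupp.weight lw d = N} =>
    (monomial d.1 (1 : ℂ)))
  haveI := finiteDimensional_levelPiece N
  exact ((Submodule.finrank_mono (levelPiece_le_span N)).trans (finrank_range_le_card _)).trans (card_exp_le N)

/-- **An independent family of `p(N)` vectors of level `N` spans the level-`N` piece**: every vector
of level `N` is a combination of them. [folklore] -/
theorem mem_span_of_linearIndependent {N : ℕ} {f : Nat.Partition N → Space ℂ} (hli : LinearIndependent ℂ f)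
    (hf : ∀ I, IsWeightedHomogeneous lw (f I) N) {u : Space ℂ} (hu : IsWeightedHomogeneous lw u N) :
    u ∈ Submodule.span ℂ (Set.range f) := by
  haveI : Nonempty (Nat.Partition N) := ⟨Nat.Partition.indiscrete N⟩
  haveI := finiteDimensional_levelPiece N
  let f' : Nat.Partition N → levelPiece N := fun I => ⟨f I, (mem_weightedHomogeneousSubmodule ℂ lw N _).mpr (hf I)⟩
  have hli' : LinearIndependent ℂ f' := LinearIndependent.of_comp (levelPiece N).subtype (by exact hli)
  have hcard : Fintype.card (Nat.Partition N) = Module.finrank ℂ (levelPiece N) :=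
    le_antisymm hli'.fintype_card_le_finrank (finrank_levelPiece_le N)
  have htop := hli'.span_eq_top_of_card_eq_finrank hcard
  have hu' : (⟨u, (mem_weightedHomogeneousSubmodule ℂ lw N _).mpr hu⟩ : levelPiece N) ∈ Submodule.span ℂ (Set.range f') := by
    rw [htop]; trivial
  have h2 := Submodule.mem_map_of_mem (f := (levelPiece N).subtype) hu'
  rw [Submodule.map_span, ← Set.range_comp] at h2
  exact h2

/-- The PBW words `e_𝕀 |μ⟩` of the Fock module have level `N`. [cite: IoharaKoga2011, §4.2.1] -/
theorem isWeightedHomogeneous_partitionVector (lam mu : ℂ) {N : ℕ} (I : Nat.Partition N) :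
    IsWeightedHomogeneous lw ((rep (R := ℂ) lam mu).partitionVector I 1) N := by
  have hmem := (rep (R := ℂ) lam mu).levelSpace_le_weightSpace (isPrimary_one lam mu).mem_weightSpace N
    ((rep (R := ℂ) lam mu).partitionVector_mem_levelSpace 1 I)
  have hL := Module.End.mem_eigenspace_iff.mp hmem
  refine isWeightedHomogeneous_of_L_zero lam mu ?_
  rw [rep_L_apply, Algebra.algebraMap_self_apply] at hL
  rw [hL]
  congr 1
  rw [hval, half, Algebra.algebraMap_self_apply]
  ring

end Fock

/-! ### The integer points: pulling the screened singular vectors back to the Verma modules -/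

section IntegerPoints

open Fock

/-- **The singular vectors at `t = p ∈ ℕ`** (`p` large): the system along the Kac curve has a
non-trivial solution at `t = p`, i.e. `V(c(p), h_{r,s}(p))` has a singular vector of level `rs`. The
screened vector `u ∈ F_{λ(β)}^{μ(β)}` (`β² = 2p`) of `Fock.exists_singularVector_fock` lies, by a
dimension count, in the span of the words `e_𝕀|μ⟩` — independent for `p` large by
`Fock.exists_finset_linearIndependent_partitionVector` — hence is the image `u = Γ(w)` of a level-`rs`
vector of the Verma module under the universal map `Γ = Verma.lift`, and `Γ(L_k w) = L_k u = 0`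
with `Γ` injective on the levels `rs - 1`, `rs - 2` gives `L_1 w = L_2 w = 0`.
[cite: IoharaKoga2011, Lemma 4.11 (proof: the two cases for (Σ_√N)^n.|η - n√N⟩ and 𝒢^η_λ = U(Vir).|η⟩)] -/
theorem exists_mulVec_eq_zero_nat (r s : ℕ) (hr : 0 < r) :
    ∃ p₀ : ℕ, ∀ p : ℕ, p₀ ≤ p →
      ∃ a : Nat.Partition (r * s) → ℂ, a ≠ 0 ∧ (Matrix.evalAt (sysMatrix r s (r * s)) (p : ℂ)).mulVec a = 0 := by
  classical
  set N := r * s with hN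
  obtain ⟨bad0, hbad0⟩ := exists_finset_linearIndependent_partitionVector r s N
  obtain ⟨bad1, hbad1⟩ := exists_finset_linearIndependent_partitionVector r s (N - 1)
  obtain ⟨bad2, hbad2⟩ := exists_finset_linearIndependent_partitionVector r s (N - 2)
  set bad := bad0 ∪ bad1 ∪ bad2 with hbad
  refine ⟨bad.sup (fun β => ⌈‖β‖ ^ 2⌉₊) + 1, fun p hp => ?_⟩
  have hp0 : 0 < p := by omega
  obtain ⟨β, hβ⟩ := IsAlgClosed.exists_pow_nat_eq (2 * p : ℂ) two_pos
  have hβ0 : β ≠ 0 := by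
    rintro rfl
    rw [zero_pow two_ne_zero] at hβ
    have : (p : ℂ) = 0 := by linear_combination -hβ / 2
    exact hp0.ne' (by exact_mod_cast this)
  -- `β` avoids the bad set
  have hβbad : β ∉ bad := by
    intro hmem
    have h1 : ⌈‖β‖ ^ 2⌉₊ ≤ bad.sup (fun β => ⌈‖β‖ ^ 2⌉₊) := Finset.le_sup (f := fun β => ⌈‖β‖ ^ 2⌉₊) hmem
    have h2 : ‖β‖ ^ 2 = 2 * p := by
      rw [← norm_pow, hβ]
      exact_mod_cast Complex.norm_natCast (2 * p)
    rw [h2, show ((2 : ℝ) * p) = ((2 * p : ℕ) : ℝ) by push_cast; ring, Nat.ceil_natCast] at h1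
    omega
  simp only [hbad, Finset.mem_union, not_or] at hβbad
  obtain ⟨⟨hb0, hb1⟩, hb2⟩ := hβbad
  have hli0 := hbad0 β hb0
  have hli1 := hbad1 β hb1
  have hli2 := hbad2 β hb2
  -- the Fock parameters
  set lam := lamOf β with hlam
  set mu := muOf r s β with hmu
  have hp' : (p : ℂ) = β ^ 2 / 2 := by rw [hβ]; ring
  have hββ : β * β⁻¹ = 1 := mul_inv_cancel₀ hβ0
  have hinv : ((β ^ 2 / 2)⁻¹ : ℂ) = 2 * β⁻¹ ^ 2 := by rw [inv_div, inv_pow]; ring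
  have hl : β * lam = p - 1 := by
    rw [hlam, lamOf, hp']; linear_combination (-1 : ℂ) * hββ
  have hm : β * mu = (r + 1) * p - (s + 1) := by
    rw [hmu, muOf, hp']; linear_combination (-((s : ℂ) + 1)) * hββ
  obtain ⟨u, hu0, huhom, huann, -⟩ := exists_singularVector_fock p r s hp0 hr hβ hl hm
  -- central charge and weight of the Fock vacuum
  have hc : (1 - 12 * lam ^ 2) = centralChargeOf (p : ℂ) := by
    rw [centralChargeOf, hlam, lamOf, hp', hinv]; linear_combination (12 : ℂ) * hββ
  have hh : mu * (mu - 2 * lam) / 2 = kacWeight (p : ℂ) r s := by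
    rw [kacWeight, hmu, hlam, muOf, lamOf, hp', hinv]
    push_cast
    linear_combination (-((r : ℂ) * s - 1) / 2) * hββ
  set c₀ := centralChargeOf (p : ℂ) with hc₀
  set h₀ := kacWeight (p : ℂ) r s with hh₀
  -- the universal map `Γ : V(c(p), h_{r,s}(p)) → F`
  set F := rep (R := ℂ) lam mu with hF
  set S := F.ofEq hc with hS
  have hprimS : S.IsPrimary 1 h₀ := (isPrimary_one lam mu).ofEq hc hh
  set φ := Verma.lift S hprimS with hφ
  have hφe : ∀ {n : ℕ} (I : Nat.Partition n),
      φ ((Verma.rep c₀ h₀).partitionVector I (Verma.hw c₀ h₀)) = F.partitionVector I 1 := fun I =>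
    Verma.lift_partitionVector S hprimS I
  -- `Γ` is injective on a level where the Fock words are independent
  have hinj : ∀ {n : ℕ}, LinearIndependent ℂ (fun I : Nat.Partition n => F.partitionVector I 1) →
      ∀ x ∈ (Verma.rep c₀ h₀).levelSpace (Verma.hw c₀ h₀) n, φ x = 0 → x = 0 := by
    intro n hli x hx hx0
    obtain ⟨a, rfl⟩ := (Submodule.mem_span_range_iff_exists_fun ℂ).mp hx
    rw [map_sum] at hx0
    simp_rw [map_smul, hφe] at hx0
    have ha : ∀ I, a I = 0 := Fintype.linearIndependent_iff.mp hli a hx0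
    exact Finset.sum_eq_zero fun I _ => by rw [ha I]; exact zero_smul ℂ ((Verma.rep c₀ h₀).partitionVector I _)
  -- `u` is in the image of the level-`N` space
  have hspan : u ∈ Submodule.span ℂ (Set.range fun I : Nat.Partition N => F.partitionVector I 1) :=
    mem_span_of_linearIndependent hli0 (fun I => isWeightedHomogeneous_partitionVector lam mu I) huhom
  obtain ⟨a, ha⟩ := (Submodule.mem_span_range_iff_exists_fun ℂ).mp hspan
  have hw : φ (coordVec N c₀ h₀ a) = u := by
    rw [coordVec, map_sum, ← ha]
    exact Finset.sum_congr rfl fun I _ => by rw [map_smul, hφe]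
  have ha0 : a ≠ 0 := by
    rintro rfl
    apply hu0
    rw [← hw, (coordVec_eq_zero_iff N c₀ h₀ 0).mpr rfl, map_zero]
  -- `L_1 w = L_2 w = 0`
  have hLk : ∀ (k : ℕ) (hk : 0 < k), LinearIndependent ℂ (fun I : Nat.Partition (N - k) => F.partitionVector I 1) →
      (Verma.rep c₀ h₀).L k (coordVec N c₀ h₀ a) = 0 := by
    intro k hk hli
    refine hinj hli _ ?_ ?_
    · rw [L_coordVec N k hk]
      exact Submodule.sum_mem _ fun J _ => Submodule.smul_mem _ _ ((Verma.rep c₀ h₀).partitionVector_mem_levelSpace _ J)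
    · rw [hφ, Verma.lift_L, ← hφ, hw, hS, VirasoroRep.ofEq_L]
      exact huann k (by exact_mod_cast hk)
  refine ⟨a, ha0, (sysMatrix_mulVec_eq_zero_iff r s N (by exact_mod_cast hp0.ne') a).mpr ⟨?_, ?_⟩⟩
  · exact hLk 1 one_pos hli1
  · exact hLk 2 two_pos hli2

/-- The system has non-trivial solutions at infinitely many points of the curve. [cite: IoharaKoga2011, Lemma 4.12 (proof: "det = 0 on infinitely many points of 𝒱_{r,s}")] -/
theorem infinite_setOf_mulVec_eq_zero (r s : ℕ) (hr : 0 < r) :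
    Set.Infinite {t : ℂ | ∃ a : Nat.Partition (r * s) → ℂ, a ≠ 0 ∧
      (Matrix.evalAt (sysMatrix r s (r * s)) t).mulVec a = 0} := by
  obtain ⟨p₀, hp₀⟩ := exists_mulVec_eq_zero_nat r s hr
  refine Set.infinite_of_injective_forall_mem (f := fun n : ℕ => ((n + p₀ : ℕ) : ℂ))
    (Nat.cast_injective.comp (add_left_injective p₀)) fun n => ?_
  exact hp₀ (n + p₀) (by omega)

end IntegerPoints

/-! ### Iohara–Koga Proposition 5.2 and the Kac character -/

/-- **Existence of the level-`rs` singular vectors (Iohara–Koga Proposition 5.2 / Corollary 5.1,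
Feigin–Fuchs).** For every `t ≠ 0`, `r ≥ 1` and `s`, the Verma module `V(c(t), h_{r,s}(t))` has a
non-zero primary vector of weight `h_{r,s}(t) + rs` (a singular vector of level `rs`).
[cite: IoharaKoga2011, Proposition 5.2 and Corollary 5.2] -/
theorem Verma.exists_singularVector_kac (t : ℂ) (ht : t ≠ 0) (r s : ℕ) (hr : 1 ≤ r) :
    ∃ w : Verma (centralChargeOf t) (kacWeight t r s), w ≠ 0 ∧
      (Verma.rep (centralChargeOf t) (kacWeight t r s)).IsPrimary w (kacWeight t r s + (r * s : ℕ)) :=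
  exists_singular_of_infinite r s (r * s) (infinite_setOf_mulVec_eq_zero r s hr) ht

/-- **The character of the Kac quotient** (the named fact `KacCharacter` of
`Literature.RepresentationTheory.Virasoro.VermaModule`, Pearce–Rasmussen–Zuber §2.2): for `t ≠ 0`
and `r, s ≥ 1`, `dim (K_{r,s})_{h_{r,s}+n} = p(n) - p(n - rs)`.
[cite: PearceRasmussenZuber2006, §2.2] [cite: IoharaKoga2011, Proposition 5.1 and Proposition 5.2] -/
theorem KacCharacter_holds : KacCharacter :=
  KacCharacter_of_exists_singular fun t ht r s hr _ => Verma.exists_singularVector_kac t ht r s hr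


end Literature.RepresentationTheory.Virasoro

end
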